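import Summits.AtomisticToContinuum.BoseEinsteinCondensation.Theses.BECThomsonPrinciple

/-!
# Route BECThomsonPrinciple — support item `TargetOfCruxes`

Glue to the route target (item stmt-AtomisticToContinuum-14102): the three assembly cruxes
`GaussianDominationCan`, `GDTransfer`, `PeriodicToDirichlet` give `Target`, because `Target` is
definitionally the conjunction `GaussianDominationCan ∧ GDTransfer ∧ PeriodicToDirichlet`
(its three conjuncts are the same terms, written under a term-level `open … in`).
Pure logic; no mathematics.
-/

namespace Summit.AtomisticToContinuum.BoseEinsteinCondensation.Theorems.BECThomsonPrinciple

open Summit.AtomisticToContinuum.BoseEinsteinCondensation.Theses.BECThomsonPrinciple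

/-- The route target of BECThomsonPrinciple is, definitionally, the conjunction of its three
assembly cruxes `GaussianDominationCan ∧ GDTransfer ∧ PeriodicToDirichlet`. -/
theorem target_eq :
    Target = (GaussianDominationCan ∧ GDTransfer ∧ PeriodicToDirichlet) := rfl

/-- Support item `TargetOfCruxes` (stmt-AtomisticToContinuum-14102) of route BECThomsonPrinciple:
`GaussianDominationCan → GDTransfer → PeriodicToDirichlet → Target`, by the anonymous constructor
(the target is rfl-equal to the conjunction of its three hypotheses, `target_eq`). -/
theorem targetOfCruxes_proof :
    Summit.AtomisticToContinuum.BoseEinsteinCondensation.Theses.BECThomsonPrinciple.TargetOfCruxes := by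
  unfold TargetOfCruxes
  intro hG hT hP
  rw [target_eq]
  exact ⟨hG, hT, hP⟩

end Summit.AtomisticToContinuum.BoseEinsteinCondensation.Theorems.BECThomsonPrinciple
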